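import Literature.Analysis.FunctionSpaces.SobolevPoincareBall
import HarnessLib

/-!
# The Sobolev–Poincaré inequality `‖v - (v)_{B₁}‖_{L⁶(B₁)} ≤ C ‖∇v‖_{L²(B₁)}` in three dimensions

Analysis/FunctionSpaces support file (serves the decomposition of the ε-regularity criterion
`Literature.Analysis.FluidPDE.ckn_epsilon_regularity`, Caffarelli–Kohn–Nirenberg 1982, Prop. 2,
through the local pressure estimate `Literature.Analysis.FluidPDE.pressureEstimate`;
Robinson–Rodrigo–Sadowski 2016, proof of Lemma 16.7, p. 252: "`‖u‖_{L²(B₁)} ‖u - (u)₁‖_{L⁶(B₁)}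
≤ C ‖u‖_{L²(B₁)} ‖∇u‖_{L²(B₁)}`", i.e. the Sobolev–Poincaré inequality for mean-zero `H¹`
vector fields on the unit ball).

On a three-dimensional real inner product space and for functions with values in a complete
normed space `F` we prove (`exists_eLpNorm_sub_average_six_le_unitBall`): there is `C` such that
for every `v ∈ W^{1,2}(B₁; F)` with weak derivative `Dv`,
`‖v - ⨍_{B₁} v‖_{L⁶(B₁)} ≤ C ‖Dv‖_{L²(B₁)}`.
Proof: the Poincaré–Wirtinger inequality with `p = 2` on the bounded connected Lipschitz domain
`B₁` (the tree's `Literature.Analysis.FunctionSpaces.poincare_wirtinger_holds` with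
`isLipschitzDomain_ball`) and the Sobolev embedding `W^{1,2}(B₁) ⊂ L⁶(B₁)`
(`Literature.Analysis.FunctionSpaces.exists_eLpNorm_le_of_memSobolevDomain_one`, `p = 2`, `p* = 6`)
applied to `v - ⨍ v`, whose weak derivative is again `Dv` (`HasWeakFDerivOn.sub_const'`).

## References

* J. C. Robinson, J. L. Rodrigo, W. Sadowski, *The three-dimensional Navier–Stokes equations*,
  Cambridge Studies in Advanced Mathematics 157 (2016), proof of Lemma 16.7, p. 252.
* L. C. Evans, *Partial Differential Equations*, 2nd ed. (2010), §5.6.3 Thm. 6, §5.8.1 Thm. 1.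
-/

noncomputable section

open MeasureTheory Set Filter Topology TopologicalSpace Metric Module
open scoped NNReal ENNReal

namespace Literature.Analysis.FunctionSpaces

variable {E' : Type*} [NormedAddCommGroup E'] [InnerProductSpace ℝ E'] [MeasurableSpace E']
  [BorelSpace E'] [FiniteDimensional ℝ E']
  {F : Type*} [NormedAddCommGroup F] [NormedSpace ℝ F]

/-- Subtracting a constant vector does not change the weak derivative (on any open set, Haar
measure). [folklore] -/
theorem HasWeakFDerivOn.sub_const' {Ω : Opens E'} {μ : Measure E'} [μ.IsAddHaarMeasure]
    {f : E' → F} {g : E' → E' →L[ℝ] F} (h : HasWeakFDerivOn Ω μ f g) (c : F) :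
    HasWeakFDerivOn Ω μ (fun x => f x - c) g := by
  have hc : HasWeakFDerivOn Ω μ (fun _ : E' => c) (fderiv ℝ fun _ : E' => c) :=
    HasWeakFDerivOn.of_contDiff_holds Ω μ contDiff_const
  have := h.sub hc
  have e1 : (f - fun _ : E' => c) = fun x => f x - c := rfl
  have e2 : (g - fderiv ℝ fun _ : E' => c) = g := by
    funext x; simp
  rwa [e1, e2] at this

variable [CompleteSpace F]

/-- **The Sobolev–Poincaré inequality for mean-zero `H¹` fields on the unit ball of a
three-dimensional space**: there is `C` such that for every `v ∈ W^{1,2}(B₁; F)` with weak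
derivative `Dv` on the unit ball,
`‖v - ⨍_{B₁} v‖_{L⁶(B₁)} ≤ C ‖Dv‖_{L²(B₁)}` (Poincaré–Wirtinger with `p = 2` and the embedding
`W^{1,2}(B₁) ⊂ L⁶(B₁)` applied to `v - ⨍ v`; Robinson–Rodrigo–Sadowski 2016, proof of Lemma 16.7,
p. 252). [cite: RobinsonRodrigoSadowski2016, proof of Lemma 16.7 p. 252] -/
theorem exists_eLpNorm_sub_average_six_le_unitBall (hE : finrank ℝ E' = 3) :
    ∃ C : ℝ≥0, ∀ (v : E' → F) (Dv : E' → E' →L[ℝ] F),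
      MemSobolevDomain 1 2 (⟨ball (0 : E') 1, isOpen_ball⟩ : Opens E') volume v →
      HasWeakFDerivOn (⟨ball (0 : E') 1, isOpen_ball⟩ : Opens E') volume v Dv →
      eLpNorm (fun x => v x - ⨍ y in ball (0 : E') 1, v y) 6
          (volume.restrict (ball (0 : E') 1)) ≤
        C * eLpNorm Dv 2 (volume.restrict (ball (0 : E') 1)) := by
  set B : Opens E' := ⟨ball (0 : E') 1, isOpen_ball⟩ with hB
  have hBL : IsLipschitzDomain B := isLipschitzDomain_ball (0 : E') 1
  have hBb : Bornology.IsBounded (B : Set E') := isBounded_ball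
  have hBconn : IsConnected (B : Set E') := (convex_ball (0 : E') 1).isConnected
    ⟨0, mem_ball_self one_pos⟩
  -- Poincaré–Wirtinger with `p = 2`
  obtain ⟨CP, hCP⟩ := poincare_wirtinger_holds (F := F) hBL hBb hBconn 2 one_le_two volume
  -- Sobolev embedding `W^{1,2} ⊂ L⁶`
  have hn : ((2 : ℝ≥0) : ℝ) < finrank ℝ E' := by rw [hE]; norm_num
  have hp' : (((6 : ℝ≥0) : ℝ))⁻¹ = ((2 : ℝ≥0) : ℝ)⁻¹ - (finrank ℝ E' : ℝ)⁻¹ := by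
    rw [hE]; push_cast; norm_num
  obtain ⟨CS, hCS⟩ := exists_eLpNorm_le_of_memSobolevDomain_one (F := F) hBL hBb (p := 2)
    (p' := 6) one_le_two hn hp' volume
  refine ⟨CS * (CP + 1), fun v Dv hv hDv => ?_⟩
  set c : F := ⨍ y in ball (0 : E') 1, v y with hc
  set h : E' → F := fun x => v x - c with hh
  have hDh : HasWeakFDerivOn B volume h Dv := hDv.sub_const' c
  -- `h ∈ W^{1,2}(B₁)` with derivative `Dv`
  have hvL2 : MemLp v 2 (volume.restrict (B : Set E')) := hv.memLp
  haveI : IsFiniteMeasure (volume.restrict (B : Set E')) :=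
    isFiniteMeasure_restrict.2 hBb.measure_lt_top.ne
  have hhL2 : MemLp h 2 (volume.restrict (B : Set E')) := hvL2.sub (memLp_const c)
  have hDvL2 : ∀ w, MemLp (fun x => Dv x w) 2 (volume.restrict (B : Set E')) := by
    obtain ⟨-, g', hg', hg'1⟩ := (memSobolevDomain_succ_iff (k := 0)).1 hv
    have hae := HasWeakFDerivOn.unique_holds hg' hDv
    intro w
    have h1 : MemLp (fun x => g' x w) 2 (volume.restrict (B : Set E')) :=
      (memSobolevDomain_zero_iff).1 (hg'1 w)
    exact h1.ae_eq (hae.mono fun x hx => by rw [hx])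
  have hhW : MemSobolevDomain 1 ((2 : ℝ≥0) : ℝ≥0∞) B volume h := by
    refine (memSobolevDomain_succ_iff (k := 0)).2 ⟨by exact_mod_cast hhL2, Dv, hDh, fun w => ?_⟩
    rw [memSobolevDomain_zero_iff]
    exact_mod_cast hDvL2 w
  have hS := hCS h Dv hhW hDh
  have hP := hCP v Dv hv hDv
  have e6 : ((6 : ℝ≥0) : ℝ≥0∞) = (6 : ℝ≥0∞) := rfl
  have e2 : ((2 : ℝ≥0) : ℝ≥0∞) = 2 := rfl
  rw [e6, e2] at hS
  calc eLpNorm h 6 (volume.restrict (B : Set E'))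
      ≤ CS * (eLpNorm h 2 (volume.restrict (B : Set E')) +
          eLpNorm Dv 2 (volume.restrict (B : Set E'))) := hS
    _ ≤ CS * (CP * eLpNorm Dv 2 (volume.restrict (B : Set E')) +
          eLpNorm Dv 2 (volume.restrict (B : Set E'))) := by
          gcongr
          exact hP
    _ = (CS * (CP + 1) : ℝ≥0) * eLpNorm Dv 2 (volume.restrict (B : Set E')) := by
          push_cast; ring

end Literature.Analysis.FunctionSpaces
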